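import Mathlib
import HarnessLib
import Literature.MathematicalPhysics.QuantumLattice.SymmetricRegimeFunctionalsD4
import Literature.MathematicalPhysics.QuantumLattice.HubbardTorusCurrentParity
import Summits.HubbardSuperconductivity.HubbardSuperconductivity.Theorems.KLProgrammeSectorisedLegKernelsDefs
import Summits.HubbardSuperconductivity.HubbardSuperconductivity.Theorems.KLProgrammeKLRegimeSplitConsts

/-!
# Route `KLProgramme` — crux K3, ENGINE child (`KLRegimeEngine`, clause (E0) `SelfEnergySymmetric`): the two GEOMETRIC
# conjuncts of the self-energy symmetry at every scale — `D₄` invariance and evenness in the momentum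

Cell gate-hubbard-kl, seat p3 (g4); first deliverable of T3RUNG item 1 (HOME/p1/T3RUNG-SCOPE.md §0 item 1, §1 (a)).  The engine
slot `EngineBoundsAtV4S … n` (bundle of record `klPredsV6`) opens with (E0) `SelfEnergySymmetric L M β U μ K n`
(`KLProgrammeKLRegimeSplitPredicates.lean`): four model-symmetry facts about the scale-`n` self-energy
`klSelfEnergy … n = selfEnergy (klEffectiveAction … n)`, where `klEffectiveAction … n = hubbardEffectiveActionCT L M β U μ 0 K (klScale e₀ n)`
is the SEEDLESS (`h = 0`) countertermed effective action (D1, `KLProgrammeSectorisedLegKernelsDefs.lean`).  Two of the four are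
geometric and are closed here for EVERY scale, frequency, spin and cutoff parameter `e₀`, directly from the tree's `D₄` symmetry of
`𝒢^K_Λ` (`Literature/…/HubbardEffectiveActionCTSymmetry.lean`, `SymmetricRegimeFunctionalsD4.lean`):
* `klSelfEnergy_d4Site` — `Σ_n((ω, γk⃗), σ) = Σ_n((ω, k⃗), σ)` for every `γ ∈ D₄` (conjunct (iv));
* `klSelfEnergy_neg` — `Σ_n((ω, −k⃗), σ) = Σ_n((ω, k⃗), σ)` (conjunct (iii): parity `k⃗ ↦ −k⃗` is the rotation `r² ∈ D₄`).
The remaining conjuncts — (ii) spin independence (BGM 2006 §2.1 symmetry (1), spin exchange) and (i) `Σ_n(−ω₀) = conj Σ_n(ω₀)`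
(symmetry (5), complex conjugation, antilinear) — need relabelling / conjugation statements for `effAction` that the tree does not
yet have; they follow in companion files.  Everything here is proved; no definitions.
-/

noncomputable section

namespace Summit.HubbardSuperconductivity.HubbardSuperconductivity.Theorems.KLProgrammeLegKernels

set_option linter.dupNamespace false -- summit = problem name (single-conjunct summit), D-0017

open Literature.MathematicalPhysics.QuantumLattice Literature.Probability.LatticeModels
open Summit.HubbardSuperconductivity.HubbardSuperconductivity.Theorems.KLRegimeSplit (klE0)

section Model

variable (L M : ℕ) [NeZero L]

/-- The scale-`n` action of the KL programme IS the seedless countertermed effective action at cutoff `klScale e₀ n`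
(definitional unfolding, recorded for rewriting). -/
theorem klEffectiveAction_eq (β U μ : ℝ) (K : TrigPolyC4v) (e₀ : ℝ) (n : ℕ) :
    klEffectiveAction L M β U μ K e₀ n = hubbardEffectiveActionCT L M β U μ 0 K (klScale e₀ n) := rfl

/-- The scale-`n` self-energy IS the self-energy functional of `𝒢^K_{Λ_n}` (definitional unfolding). -/
theorem klSelfEnergy_eq (β U μ : ℝ) (K : TrigPolyC4v) (e₀ : ℝ) (n : ℕ) (k : FreqMomentum L M) (σ : Fin 2) :
    klSelfEnergy L M β U μ K e₀ n k σ = selfEnergy L M β (hubbardEffectiveActionCT L M β U μ 0 K (klScale e₀ n)) k σ := rfl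

/-- **Conjunct (iv) of (E0) at every scale: `D₄` invariance of the scale-`n` self-energy in the spatial momentum**,
`Σ_n((ω, γk⃗), σ) = Σ_n((ω, k⃗), σ)` for every `γ ∈ D₄`, every frequency `ω`, spin `σ`, frame `K` and cutoff parameter `e₀`. -/
theorem klSelfEnergy_d4Site (β U μ : ℝ) (K : TrigPolyC4v) (e₀ : ℝ) (n : ℕ) (γ : DihedralGroup 4) (ω : MatsubaraIdx M)
    (k : TorusSite 2 L) (σ : Fin 2) :
    klSelfEnergy L M β U μ K e₀ n (ω, d4Site γ k) σ = klSelfEnergy L M β U μ K e₀ n (ω, k) σ :=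
  selfEnergy_hubbardEffectiveActionCT_d4Site L M β U μ K (klScale e₀ n) γ ω k σ

/-- **Conjunct (iii) of (E0) at every scale: the scale-`n` self-energy is even in the spatial momentum**,
`Σ_n((ω, −k⃗), σ) = Σ_n((ω, k⃗), σ)` — parity is the element `r²` of `D₄` (BGM 2006 §2.1, symmetry (4)). -/
theorem klSelfEnergy_neg (β U μ : ℝ) (K : TrigPolyC4v) (e₀ : ℝ) (n : ℕ) (ω : MatsubaraIdx M) (k : TorusSite 2 L) (σ : Fin 2) :
    klSelfEnergy L M β U μ K e₀ n (ω, -k) σ = klSelfEnergy L M β U μ K e₀ n (ω, k) σ := by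
  rw [← d4Site_r_two (L := L) k]
  exact klSelfEnergy_d4Site L M β U μ K e₀ n (DihedralGroup.r 2) ω k σ

/-- The two geometric conjuncts of `SelfEnergySymmetric … n` together, in the clause's own shape (frequency `ω₀`, `e₀ = klE0`):
for every `k⃗`, `σ`: `Σ_n((ω₀, −k⃗), σ) = Σ_n((ω₀, k⃗), σ)` and `∀ γ ∈ D₄, Σ_n((ω₀, γk⃗), σ) = Σ_n((ω₀, k⃗), σ)`. -/
theorem klSelfEnergy_geometric [NeZero M] (β U μ : ℝ) (K : TrigPolyC4v) (n : ℕ) (k : TorusSite 2 L) (σ : Fin 2) :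
    klSelfEnergy L M β U μ K klE0 n (omega0 M, -k) σ = klSelfEnergy L M β U μ K klE0 n (omega0 M, k) σ ∧
      ∀ g : DihedralGroup 4,
        klSelfEnergy L M β U μ K klE0 n (omega0 M, d4Site g k) σ = klSelfEnergy L M β U μ K klE0 n (omega0 M, k) σ :=
  ⟨klSelfEnergy_neg L M β U μ K klE0 n (omega0 M) k σ, fun g => klSelfEnergy_d4Site L M β U μ K klE0 n g (omega0 M) k σ⟩

end Model

end Summit.HubbardSuperconductivity.HubbardSuperconductivity.Theorems.KLProgrammeLegKernels

end
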